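import Summits.CriticalPhenomena.PercolationContinuityZ3.Theorems.Transplant.SkelPhiRunExitTable
import HarnessLib

/-!
# N1 (the `{±1}` node), LEVEL 1, kit adapter file N-K8h: **EXIT GOALS FOR A GENERAL INTEGER LINE FORM `F = a·α + b·β`** (hp-8 g33's v-FACE level
# sides, whose level lines run along `(v_L, vβL)`: `(a, b) = (vβL, −v_L)`) — the cousin of (L2): from the kit pair `(n, h, ℓ, v)` in either
# orientation a SINGLE piece with `e·F ≥ C·(|a| + |b|)` always exists, by the case split
#   `X := |n·a + h·b| ≥ C(|a|+|b|)` ⇒ the x side half `(e·sgnz(n·a+h·b), e·sgnz b)`  (`n·e·F = n·X + |b|·|β′| ≥ n·X`),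
#   `X < C(|a|+|b|)`            ⇒ the top piece `(e·sgnz b, τ, v)`  (`n·e·F ≥ |b|·(nℓ − (n+|h|) + 1) − n·X`, and the kit pair's own
#                                 EqGeom `(M+1)(n+|h|) ≤ n(ℓ+1)` with `M ≥ 4C+1`, `n ≥ 2C` gives `|b|(nℓ − (n+|h|) + 1) > n(X + C(|a|+|b|))`),
# transposed pair: the same with `(a, b) ↦ (b, a)`.  The termwise bound `|b|(ℓ − |h| − 11) − |a|·n` for the top piece (which fails when
# `(a,b) ⊥ (n,h)`, `|h| ≈ n`, `ℓ < 2n`) loses the `α–β` correlation on the slanted top: there `n·F = (n·a + h·b)·α + b·β′` and `β′` sits in the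
# top layer, so in the "bad lattice" the top piece is in fact the FARTHEST piece from the line.  NO new LEVEL-0 fact, no floor beyond
# `M_kit ≥ 4C+1`, `n_kit ≥ 2C` (`C = nz + 5`; both far inside `KS.MK ≥ 24M_u+63`, `KS.nKit ≥ 22M_u+58`)

builds on p205010 (kernel theorem, internal audit signed; external expert review pending) — nothing in this file uses p205010; nothing here is a
claim about the open node `SamePDropOfSkeletonNeg₁`.
Lane `prim-bschramm`, seat `prim-bschramm-p1` (gen 12; kit-layer defect desk, answering hp-8 g33 2026-08-21 18:1xZ); helper file
(`--supports stmt-CriticalPhenomena-4575 --as helper`).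
* §1 `vlineGoal_same_half`, `vlineGoal_same_top`, `vlineGoal_tr_half`, `vlineGoal_tr_top` (the four exit quantities);
* §2 `vline_abs_a_lt` (`X < C(|a|+|b|) ⇒ (n−C)|a| < |b|(C+|h|)`), **`vline_arith`** (`⇒ n·(X + C(|a|+|b|)) < |b|·(nℓ − (n+|h|) + 1)`);
* §3 the one-piece table **`pexVL G φ Q C a b e c`** over `ShortPcO` (orientation-aware), `pexVL_subset` (⊆ `RgO`), **`pexVL_goal`**
  (`C·(|a|+|b|) ≤ e·(a·α + b·β)` on every vertex, hypotheses per centre: EqGeom of the kit pair, `4C+1 ≤ M`, `2C ≤ n_s`).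
[cite: MartineauTassion2017, §3.2 (the pieces L(a,u), L(u,b), L(−a,v), L(v,b))] [cite: KozmaNitzan2024, §4 p. 20 (Step IV)]
-/

noncomputable section

open scoped Classical

namespace Summit.CriticalPhenomena.PercolationContinuityZ3.Theorems.Transplant

namespace Skelφ

open Literature.Probability.Percolation Literature.Probability.LatticeModels SimpleGraph

variable {V : Type} {G : SimpleGraph V} [G.LocallyFinite] {φ : V → Site 2}

/-! ## §0 Sign bookkeeping -/

omit [G.LocallyFinite] in
/-- `sgnz x · sgnz x = 1`. [folklore] -/
theorem sgnz_mul_sgnz (x : ℤ) : sgnz x * sgnz x = 1 := by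
  rcases sgnz_cases x with h | h <;> rw [h] <;> norm_num

omit [G.LocallyFinite] in
/-- `x = sgnz x · |x|`. [folklore] -/
theorem eq_sgnz_mul_abs (x : ℤ) : x = sgnz x * |x| := by
  have h1 := sgnz_mul_self x
  have h2 := sgnz_mul_sgnz x
  calc x = (sgnz x * sgnz x) * x := by rw [h2, one_mul]
    _ = sgnz x * (sgnz x * x) := by ring
    _ = sgnz x * |x| := by rw [h1]

omit [G.LocallyFinite] in
/-- `n·(a·α + b·β) = (n·a + h·b)·α + b·β′` with `β′ = n·β − h·α`. [folklore] -/
theorem lineForm_shear (φ : V → Site 2) (c : V) (n : ℕ) (h a b : ℤ) (w : V) :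
    (n : ℤ) * (a * relCoord φ c 0 w + b * relCoord φ c 1 w) = ((n : ℤ) * a + h * b) * relCoord φ c 0 w + b * shearCoord φ c n h w := by
  simp only [shearCoord_apply, relCoord_apply]; ring

/-! ## §1 The exit quantities of the four shapes for the form `F = a·α + b·β` -/

section Goals

variable {c w : V} {n ℓ R : ℕ} {h a b e τ v : ℤ}

/-- SAME orientation, SIDE HALF `(e·sgnz(n·a + h·b), e·sgnz b)`: `e·F ≥ |n·a + h·b|` (`1 ≤ n`). [this work] -/
theorem vlineGoal_same_half (he : e = 1 ∨ e = -1) (hn : 1 ≤ n)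
    (hw : w ∈ pgSideHalfW G φ c n h ℓ R (e * sgnz ((n : ℤ) * a + h * b)) (e * sgnz b)) :
    |(n : ℤ) * a + h * b| ≤ e * (a * relCoord φ c 0 w + b * relCoord φ c 1 w) := by
  obtain ⟨-, -, hα, hτ⟩ := (mem_pgSideHalfW G φ).1 hw
  set X := (n : ℤ) * a + h * b with hX
  have he2 : e * e = 1 := by rcases he with rfl | rfl <;> simp
  have hn0 : (0 : ℤ) < n := by exact_mod_cast hn
  have hid := lineForm_shear φ c n h a b w
  have h1 : e * (X * relCoord φ c 0 w) = |X| * n := by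
    rw [hα]
    calc e * (X * (e * sgnz X * n)) = (e * e) * (sgnz X * X) * n := by ring
      _ = |X| * n := by rw [he2, sgnz_mul_self, one_mul]
  have h2 : 0 ≤ e * (b * shearCoord φ c n h w) := by
    have : e * (b * shearCoord φ c n h w) = |b| * ((e * sgnz b) * shearCoord φ c n h w) := by
      conv_lhs => rw [eq_sgnz_mul_abs b]
      ring
    rw [this]; exact mul_nonneg (abs_nonneg _) hτ
  have h3 : (n : ℤ) * (e * (a * relCoord φ c 0 w + b * relCoord φ c 1 w)) = e * (X * relCoord φ c 0 w) + e * (b * shearCoord φ c n h w) := by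
    rw [show (n : ℤ) * (e * (a * relCoord φ c 0 w + b * relCoord φ c 1 w)) = e * ((n : ℤ) * (a * relCoord φ c 0 w + b * relCoord φ c 1 w)) by ring,
      hid]; ring
  refine le_of_mul_le_mul_left ?_ hn0
  rw [h3, h1]; nlinarith [h2, abs_nonneg X]

/-- SAME orientation, TOP PIECE `(e·sgnz b, τ, v)`: `n·e·F ≥ |b|·(n·ℓ − (n+|h|) + 1) − n·|n·a + h·b|`. [this work] -/
theorem vlineGoal_same_top (he : e = 1 ∨ e = -1) (hw : w ∈ pgTopPieceW G φ c n h ℓ R (e * sgnz b) τ v) :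
    |b| * ((n : ℤ) * ℓ - (n + |h|) + 1) - n * |(n : ℤ) * a + h * b| ≤ (n : ℤ) * (e * (a * relCoord φ c 0 w + b * relCoord φ c 1 w)) := by
  obtain ⟨-, hcyl, htop, -⟩ := (mem_pgTopPieceW G φ).1 hw
  rw [mem_pgramCyl] at hcyl
  set X := (n : ℤ) * a + h * b with hX
  have hid := lineForm_shear φ c n h a b w
  have hnat : ((n + h.natAbs : ℕ) : ℤ) = n + |h| := by push_cast; rfl
  rw [hnat] at htop
  -- the `β′` term
  have h1 : |b| * ((n : ℤ) * ℓ - (n + |h|) + 1) ≤ e * (b * shearCoord φ c n h w) := by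
    have : e * (b * shearCoord φ c n h w) = |b| * ((e * sgnz b) * shearCoord φ c n h w) := by
      conv_lhs => rw [eq_sgnz_mul_abs b]
      ring
    rw [this]
    exact mul_le_mul_of_nonneg_left (by linarith) (abs_nonneg _)
  -- the `α` term
  have h2 : -((n : ℤ) * |X|) ≤ e * (X * relCoord φ c 0 w) := by
    have hα : |relCoord φ c 0 w| ≤ n := hcyl.1
    have he1 : |e| = 1 := by rcases he with rfl | rfl <;> simp
    have : |e * (X * relCoord φ c 0 w)| ≤ n * |X| := by
      rw [abs_mul, abs_mul, he1, one_mul, mul_comm]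
      exact mul_le_mul_of_nonneg_right hα (abs_nonneg _)
    linarith [neg_abs_le (e * (X * relCoord φ c 0 w))]
  have h3 : (n : ℤ) * (e * (a * relCoord φ c 0 w + b * relCoord φ c 1 w)) = e * (X * relCoord φ c 0 w) + e * (b * shearCoord φ c n h w) := by
    rw [show (n : ℤ) * (e * (a * relCoord φ c 0 w + b * relCoord φ c 1 w)) = e * ((n : ℤ) * (a * relCoord φ c 0 w + b * relCoord φ c 1 w)) by ring,
      hid]; ring
  rw [h3]; linarith

/-- TRANSPOSED orientation, SIDE HALF `(e·sgnz(n·b + h·a), e·sgnz a)` of the pair in the chart `trφ φ`: `e·F ≥ |n·b + h·a|`. [this work] -/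
theorem vlineGoal_tr_half (he : e = 1 ∨ e = -1) (hn : 1 ≤ n)
    (hw : w ∈ pgSideHalfW G (trφ φ) c n h ℓ R (e * sgnz ((n : ℤ) * b + h * a)) (e * sgnz a)) :
    |(n : ℤ) * b + h * a| ≤ e * (a * relCoord φ c 0 w + b * relCoord φ c 1 w) := by
  have h := vlineGoal_same_half (φ := trφ φ) (a := b) (b := a) he hn hw
  rw [relCoord_trφ, relCoord_trφ] at h
  have e0 : relCoord φ c (Fin.rev 0) w = relCoord φ c 1 w := rfl
  have e1 : relCoord φ c (Fin.rev 1) w = relCoord φ c 0 w := rfl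
  rw [e0, e1] at h
  linarith

/-- TRANSPOSED orientation, TOP PIECE `(e·sgnz a, τ, v)` of the pair in the chart `trφ φ`: `n·e·F ≥ |a|·(n·ℓ − (n+|h|) + 1) − n·|n·b + h·a|`.
[this work] -/
theorem vlineGoal_tr_top (he : e = 1 ∨ e = -1) (hw : w ∈ pgTopPieceW G (trφ φ) c n h ℓ R (e * sgnz a) τ v) :
    |a| * ((n : ℤ) * ℓ - (n + |h|) + 1) - n * |(n : ℤ) * b + h * a| ≤ (n : ℤ) * (e * (a * relCoord φ c 0 w + b * relCoord φ c 1 w)) := by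
  have h := vlineGoal_same_top (φ := trφ φ) (a := b) (b := a) he hw
  rw [relCoord_trφ, relCoord_trφ] at h
  have e0 : relCoord φ c (Fin.rev 0) w = relCoord φ c 1 w := rfl
  have e1 : relCoord φ c (Fin.rev 1) w = relCoord φ c 0 w := rfl
  rw [e0, e1] at h
  linarith

end Goals

/-! ## §2 The arithmetic of the small-`X` case -/

omit [G.LocallyFinite] in
/-- If `|n·a + h·b| < C·(|a| + |b|)` then `(n − C)·|a| < |b|·(C + |h|)`. [folklore] -/
theorem vline_abs_a_lt {n C : ℕ} {h a b : ℤ} (hX : |(n : ℤ) * a + h * b| < C * (|a| + |b|)) :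
    ((n : ℤ) - C) * |a| < |b| * (C + |h|) := by
  have htri : (n : ℤ) * |a| ≤ |(n : ℤ) * a + h * b| + |h| * |b| := by
    have h1 : |(n : ℤ) * a| ≤ |(n : ℤ) * a + h * b| + |h * b| := by
      have := abs_sub ((n : ℤ) * a + h * b) (h * b)
      rwa [add_sub_cancel_right] at this
    rw [abs_mul, abs_mul, Nat.abs_cast] at h1
    exact h1
  nlinarith [abs_nonneg a, abs_nonneg b, abs_nonneg h]

omit [G.LocallyFinite] in
/-- **The small-`X` arithmetic**: `|n·a + h·b| < C(|a|+|b|)`, the kit pair's EqGeom `(M+1)(n+|h|) ≤ n(ℓ+1)`, `M ≥ 4C+1`, `n ≥ 2C` ⟹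
`n·(|n·a + h·b| + C(|a|+|b|)) < |b|·(nℓ − (n+|h|) + 1)`. [this work] -/
theorem vline_arith {n ℓ M C : ℕ} {h a b : ℤ} (hX : |(n : ℤ) * a + h * b| < C * (|a| + |b|))
    (hEq : ((M : ℤ) + 1) * (n + |h|) ≤ (n : ℤ) * (ℓ + 1)) (hM : 4 * C + 1 ≤ M) (hn : 2 * C ≤ n) :
    (n : ℤ) * (|(n : ℤ) * a + h * b| + C * (|a| + |b|)) < |b| * ((n : ℤ) * ℓ - (n + |h|) + 1) := by
  set X := |(n : ℤ) * a + h * b| with hXdef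
  set T := (C : ℤ) * (|a| + |b|) with hT
  have hX0 : 0 ≤ X := abs_nonneg _
  have ha0 := abs_nonneg a
  have hb0 := abs_nonneg b
  have hh0 := abs_nonneg h
  have hC1 : (1 : ℤ) ≤ C := by
    by_contra hc
    have hC0 : (C : ℤ) = 0 := by omega
    have : T = 0 := by rw [hT, hC0, zero_mul]
    linarith
  have h2C : (2 : ℤ) * C ≤ n := by exact_mod_cast hn
  have hnC : (C : ℤ) ≤ (n : ℤ) - C := by linarith
  have hA := vline_abs_a_lt hX
  -- (B): (n − C)·T < C|b|(n+|h|)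
  have hB : ((n : ℤ) - C) * T < C * |b| * (n + |h|) := by
    have h1 : (C : ℤ) * (((n : ℤ) - C) * |a|) < C * (|b| * (C + |h|)) := mul_lt_mul_of_pos_left hA (by linarith)
    have h2 : ((n : ℤ) - C) * T = C * (((n : ℤ) - C) * |a|) + C * ((n : ℤ) - C) * |b| := by rw [hT]; ring
    rw [h2]; nlinarith
  -- (C): n(X+T) < 2nT ≤ 4(n−C)T < 4C|b|(n+|h|)
  have hT0 : 0 ≤ T := by rw [hT]; positivity
  have hn0 : (0 : ℤ) ≤ n := by positivity
  have hC2 : (n : ℤ) * (X + T) < 4 * C * |b| * (n + |h|) := by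
    have h1 : (n : ℤ) * (X + T) ≤ 2 * n * T := by nlinarith
    have h2 : 2 * (n : ℤ) * T ≤ 4 * ((n : ℤ) - C) * T := by nlinarith
    have h3 : 4 * ((n : ℤ) - C) * T < 4 * C * |b| * (n + |h|) := by nlinarith
    linarith
  -- (D): 4C|b|(n+|h|) ≤ (M−1)|b|(n+|h|) ≤ |b|(nℓ − (n+|h|) + 1)
  have hM1 : (4 : ℤ) * C + 1 ≤ M := by exact_mod_cast hM
  have hM' : (4 : ℤ) * C ≤ (M : ℤ) - 1 := by linarith
  have hD1 : 4 * (C : ℤ) * |b| * (n + |h|) ≤ ((M : ℤ) - 1) * (|b| * (n + |h|)) := by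
    have : 0 ≤ |b| * ((n : ℤ) + |h|) := by positivity
    nlinarith
  have hD2 : ((M : ℤ) - 1) * (n + |h|) ≤ (n : ℤ) * ℓ - (n + |h|) + 1 := by nlinarith
  have hD3 : ((M : ℤ) - 1) * (|b| * (n + |h|)) ≤ |b| * ((n : ℤ) * ℓ - (n + |h|) + 1) := by nlinarith
  linarith

/-! ## §3 The one-piece table for a line form and its exit -/

variable (G φ) in
/-- **The exit piece for the line form `F = a·α + b·β`** at a kit centre `c` (kit pair in its own orientation `Q.oS c`), threshold
`C·(|a|+|b|)`, exit sign `e`: side half if `|n·a + h·b|` (resp. `|n·b + h·a|` transposed) reaches the threshold, else the top piece. [this work] -/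
def pexVL (Q : ShortPcO V) (C : ℕ) (a b e : ℤ) (c : V) : Finset V :=
  if Q.oS c then
    (if (C : ℤ) * (|a| + |b|) ≤ |(Q.nS c : ℤ) * a + Q.hS c * b| then
      pgSideHalfW G φ c (Q.nS c) (Q.hS c) (Q.ℓS c) (Q.RS c) (e * sgnz ((Q.nS c : ℤ) * a + Q.hS c * b)) (e * sgnz b)
    else pgTopPieceW G φ c (Q.nS c) (Q.hS c) (Q.ℓS c) (Q.RS c) (e * sgnz b) 1 (Q.vS c))
  else
    (if (C : ℤ) * (|a| + |b|) ≤ |(Q.nS c : ℤ) * b + Q.hS c * a| then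
      pgSideHalfW G (trφ φ) c (Q.nS c) (Q.hS c) (Q.ℓS c) (Q.RS c) (e * sgnz ((Q.nS c : ℤ) * b + Q.hS c * a)) (e * sgnz a)
    else pgTopPieceW G (trφ φ) c (Q.nS c) (Q.hS c) (Q.ℓS c) (Q.RS c) (e * sgnz a) 1 (Q.vS c))

/-- The line-form piece lies in the short prism `RgO`. [folklore] -/
theorem pexVL_subset (Q : ShortPcO V) (C : ℕ) (a b e : ℤ) (c : V) : pexVL G φ Q C a b e c ⊆ RgO G φ Q c := by
  intro v hv
  unfold RgO; unfold pexVL at hv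
  rw [mem_pgramPrismFin]
  cases hQ : Q.oS c
  · rw [hQ] at hv; simp only [Bool.false_eq_true, if_false] at hv
    rw [(oriφ_true_false φ).2]
    split_ifs at hv
    · exact ((mem_pgSideHalfW G (trφ φ)).1 hv).1
    · exact ((mem_pgTopPieceW G (trφ φ)).1 hv).1
  · rw [hQ] at hv; simp only [if_true] at hv
    rw [(oriφ_true_false φ).1]
    split_ifs at hv
    · exact ((mem_pgSideHalfW G φ).1 hv).1
    · exact ((mem_pgTopPieceW G φ).1 hv).1

/-- **The line-form exit**: on every vertex of `pexVL`, `e·(a·α + b·β) ≥ C·(|a| + |b|)`, given the kit pair's EqGeom at the centre, `M ≥ 4C+1`,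
`n_s ≥ 2C` and `n_s ≥ 1` (any integers `a, b`; either orientation). [this work] -/
theorem pexVL_goal {Q : ShortPcO V} {C M : ℕ} {a b e : ℤ} {c w : V} (he : e = 1 ∨ e = -1) (hn1 : 1 ≤ Q.nS c)
    (hEq : ((M : ℤ) + 1) * (Q.nS c + |Q.hS c|) ≤ (Q.nS c : ℤ) * (Q.ℓS c + 1)) (hM : 4 * C + 1 ≤ M) (hn : 2 * C ≤ Q.nS c)
    (hw : w ∈ pexVL G φ Q C a b e c) : (C : ℤ) * (|a| + |b|) ≤ e * (a * relCoord φ c 0 w + b * relCoord φ c 1 w) := by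
  unfold pexVL at hw
  have hn0 : (0 : ℤ) < Q.nS c := by exact_mod_cast hn1
  cases hQ : Q.oS c
  · rw [hQ] at hw; simp only [Bool.false_eq_true, if_false] at hw
    split_ifs at hw with hX
    · exact hX.trans (vlineGoal_tr_half he hn1 hw)
    · push Not at hX
      have h := vlineGoal_tr_top (b := b) he hw
      have hX' : |(Q.nS c : ℤ) * b + Q.hS c * a| < C * (|b| + |a|) := by rwa [add_comm |b| |a|]
      have ha := vline_arith hX' hEq hM hn
      refine le_of_mul_le_mul_left ?_ hn0
      nlinarith [abs_nonneg a, abs_nonneg b]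
  · rw [hQ] at hw; simp only [if_true] at hw
    split_ifs at hw with hX
    · exact hX.trans (vlineGoal_same_half he hn1 hw)
    · push Not at hX
      have h := vlineGoal_same_top (a := a) he hw
      have ha := vline_arith hX hEq hM hn
      refine le_of_mul_le_mul_left ?_ hn0
      nlinarith [abs_nonneg a, abs_nonneg b]

end Skelφ

end Summit.CriticalPhenomena.PercolationContinuityZ3.Theorems.Transplant

end
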